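/-
VALUE = THEOREM (point counts on the isotropic cone of 𝔽_p³, toolkit for the all-`p`
reflection-class certificate), NOT summit progress (cell b2b-lgcu-borel, gen 24); the crux item
stmt-MatrixMultiplication-14079 is untouched.
-/
import Mathlib
import Literature.NumberTheory.EllipticCurves.BinaryQuarticDiscriminantFpCountProofs
import Summits.MatrixMultiplication.MatrixMultiplication.Theorems.SubgroupIdentityDesigns.Negative.ReflectionClassCharSums
import Summits.MatrixMultiplication.MatrixMultiplication.Theorems.SubgroupIdentityDesigns.Negative.ReflectionClassPlane

/-!
# Isotropic lines of `𝔽_p³`: there are `p + 1`, and `1 + χ(−Q b)` of them lie in `b^⊥`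

VALUE = THEOREM (generic in the odd prime `p`), NOT summit progress; the crux item
stmt-MatrixMultiplication-14079 is untouched and remains open.

Layer F3a of the all-`p` proof of the unified reflection-class certificate (ORACLE-g24 §G24-1 L1,
§G24-2 F3): the counts behind the permutation-sign character `ι` of `O₃(𝔽_p)` on the `p + 1`
isotropic lines (`ι(R_b) = χ(Q b)` because `R_b` fixes exactly the `1 + χ(−Q b)` isotropic lines
of `b^⊥` and pairs the remaining `p − χ(−Q b)`).
* `exists_frame` — an anisotropic `b` has an anisotropic `b × e`, so `ReflectionClassPlane` gives
  an orthogonal frame `w₁, w₂` of `b^⊥` and `sum_space` parametrises `𝔽_p³ = 𝔽_p b ⊕ b^⊥`;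
* `count_space : #{v : Q v = 0} = p²`, `count_perp : #{z ⊥ b : Q z = 0} = p + (p − 1)χ(−Q b)`
  (character sums of `ReflectionClassCharSums`);
* `card_lines` — a homogeneous condition holds on `(p − 1)·#lines` non-zero vectors;
* `card_isoLines : #{isotropic lines} = p + 1`,
  `card_isoLines_perp : #{isotropic lines in b^⊥} = 1 + χ(−Q b)`.
Lines are points of Mathlib's `Projectivization`; a condition on a line is evaluated at `ℓ.rep`.
-/

set_option linter.dupNamespace false

open scoped BigOperators Matrix LinearAlgebra.Projectivization

namespace Summit.MatrixMultiplication.MatrixMultiplication.Theorems.SubgroupIdentityDesigns.Negative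
namespace ReflectionClassIsoLines

open ReflectionClassCertificate (V)
open ReflectionClassCharSums (sum_sq sum_bqf_eq_zero)
open ReflectionClassPlane
open Literature.NumberTheory.EllipticCurves.BinaryQuartic (two_ne_zero_zmod)

variable {p : ℕ} [hp : Fact p.Prime]

/-- The (finite) projective plane over `𝔽_p`, made a `Fintype` classically. -/
noncomputable instance instFintypeLines : Fintype (ℙ (ZMod p) (V p)) := Fintype.ofFinite _

/-! ## An orthogonal frame at an anisotropic vector -/

section Frame

variable {b ω : V p}

/-- An anisotropic `b` has a coordinate vector `e` with `b × e` anisotropic (`p` odd). -/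
theorem exists_frame (hp2 : p ≠ 2) (hb : b ⬝ᵥ b ≠ 0) : ∃ ω : V p, w₁ b ω ⬝ᵥ w₁ b ω ≠ 0 := by
  by_contra h
  push Not at h
  have h0 := h ![1, 0, 0]
  have h1 := h ![0, 1, 0]
  have h2 := h ![0, 0, 1]
  simp only [w₁, cross_apply, dotProduct, Fin.sum_univ_three, Matrix.cons_val_zero,
    Matrix.cons_val_one, Matrix.cons_val_two, Matrix.head_cons, Matrix.tail_cons, mul_zero,
    mul_one, sub_zero, zero_sub, mul_neg, neg_mul, neg_neg, add_zero, zero_add] at h0 h1 h2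
  have two := two_ne_zero_zmod hp2
  have e0 : b 0 * b 0 = 0 := by
    have : (2 : ZMod p) * (b 0 * b 0) = 0 := by linear_combination h1 + h2 - h0
    exact (mul_eq_zero.mp this).resolve_left two
  have e1 : b 1 * b 1 = 0 := by
    have : (2 : ZMod p) * (b 1 * b 1) = 0 := by linear_combination h0 + h2 - h1
    exact (mul_eq_zero.mp this).resolve_left two
  have e2 : b 2 * b 2 = 0 := by
    have : (2 : ZMod p) * (b 2 * b 2) = 0 := by linear_combination h0 + h1 - h2
    exact (mul_eq_zero.mp this).resolve_left two
  apply hb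
  simp only [dotProduct, Fin.sum_univ_three, e0, e1, e2, add_zero]

/-- **Coordinates adapted to `b`:**  `v ↦ (s, u, t)` with `v = s b + u w₁ + t w₂` is a bijection,
so sums over `𝔽_p³` become triple sums. -/
theorem sum_space (hb : b ⬝ᵥ b ≠ 0) (hQ : w₁ b ω ⬝ᵥ w₁ b ω ≠ 0) (F : V p → ℤ) :
    ∑ v : V p, F v =
      ∑ s : ZMod p, ∑ u : ZMod p, ∑ t : ZMod p, F (s • b + (u • w₁ b ω + t • w₂ b ω)) := by
  set Φ : ZMod p × ZMod p × ZMod p → V p :=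
    fun q => q.1 • b + (q.2.1 • w₁ b ω + q.2.2 • w₂ b ω) with hΦ
  have hQ₂ : w₂ b ω ⬝ᵥ w₂ b ω ≠ 0 := by rw [w₂_dot_self]; exact mul_ne_zero hb hQ
  have hinj : Function.Injective Φ := by
    intro q r h
    have h1 := congrArg (fun v => v ⬝ᵥ b) h
    have h2 := congrArg (fun v => v ⬝ᵥ w₁ b ω) h
    have h3 := congrArg (fun v => v ⬝ᵥ w₂ b ω) h
    simp only [hΦ, add_dotProduct, smul_dotProduct, smul_eq_mul, w₁_dot_x, w₂_dot_x,
      dotProduct_comm b (w₁ b ω), dotProduct_comm b (w₂ b ω), dotProduct_comm (w₂ b ω) (w₁ b ω),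
      w₁_dot_w₂, mul_zero, add_zero, zero_add] at h1 h2 h3
    exact Prod.ext (mul_right_cancel₀ hb h1)
      (Prod.ext (mul_right_cancel₀ hQ h2) (mul_right_cancel₀ hQ₂ h3))
  have hbij : Function.Bijective Φ := by
    rw [Fintype.bijective_iff_injective_and_card]
    refine ⟨hinj, ?_⟩
    simp only [Fintype.card_prod, ZMod.card, Fintype.card_pi, Finset.prod_const, Finset.card_univ,
      Fintype.card_fin]
    ring
  rw [← Fintype.sum_bijective Φ hbij (fun q => F (Φ q)) F fun _ => rfl, Fintype.sum_prod_type,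
    Finset.sum_congr rfl fun _ _ => Fintype.sum_prod_type _]

end Frame

/-! ## Affine counts -/

section Counts

variable {b ω : V p}

/-- `Σ_u [u² = a] = χ(a) + 1`. -/
theorem sum_sq_eq (hp2 : p ≠ 2) (a : ZMod p) :
    ∑ u : ZMod p, (if u ^ 2 = a then (1 : ℤ) else 0) = quadraticChar (ZMod p) a + 1 := by
  have hF : ringChar (ZMod p) ≠ 2 := by rw [ZMod.ringChar_zmod_n]; exact hp2
  have h := quadraticChar_card_sqrts hF a
  rw [Set.toFinset_setOf] at h
  rw [Finset.sum_boole, h]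

/-- **Isotropic vectors of `b^⊥`:**  `#{z ⊥ b : Q z = 0} = p + (p − 1) χ(−Q b)`. -/
theorem count_perp (hp2 : p ≠ 2) (hb : b ⬝ᵥ b ≠ 0) (hQ : w₁ b ω ⬝ᵥ w₁ b ω ≠ 0) :
    ∑ z ∈ Finset.univ.filter (fun z : V p => z ⬝ᵥ b = 0), (if z ⬝ᵥ z = 0 then (1 : ℤ) else 0) =
      (p : ℤ) + ((p : ℤ) - 1) * quadraticChar (ZMod p) (-(b ⬝ᵥ b)) := by
  rw [sum_plane hb hQ]
  have key : ∀ u t : ZMod p,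
      ((u • w₁ b ω + t • w₂ b ω) ⬝ᵥ (u • w₁ b ω + t • w₂ b ω) = 0) ↔
        u ^ 2 = -(b ⬝ᵥ b) * t ^ 2 := by
    intro u t
    rw [comb_dot_self, w₂_dot_self]
    constructor
    · intro h
      have h' : (w₁ b ω ⬝ᵥ w₁ b ω) * (u ^ 2 + (b ⬝ᵥ b) * t ^ 2) = 0 := by
        linear_combination h
      linear_combination (mul_eq_zero.mp h').resolve_left hQ
    · intro h
      linear_combination (w₁ b ω ⬝ᵥ w₁ b ω) * h
  simp_rw [key]
  rw [Finset.sum_comm]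
  simp_rw [sum_sq_eq hp2, map_mul]
  rw [Finset.sum_add_distrib, Finset.sum_const, Finset.card_univ, ZMod.card, ← Finset.mul_sum,
    sum_sq, nsmul_eq_mul, mul_one]
  ring

/-- **Isotropic vectors of `𝔽_p³`:**  `#{v : Q v = 0} = p²`. -/
theorem count_space (hp2 : p ≠ 2) (hb : b ⬝ᵥ b ≠ 0) (hQ : w₁ b ω ⬝ᵥ w₁ b ω ≠ 0) :
    ∑ v : V p, (if v ⬝ᵥ v = 0 then (1 : ℤ) else 0) = (p : ℤ) ^ 2 := by
  rw [sum_space hb hQ]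
  obtain ⟨B, hB⟩ : ∃ B, B = b ⬝ᵥ b := ⟨_, rfl⟩
  obtain ⟨Q₁, hQ₁⟩ : ∃ Q, Q = w₁ b ω ⬝ᵥ w₁ b ω := ⟨_, rfl⟩
  rw [← hQ₁] at hQ
  rw [← hB] at hb
  have key : ∀ s u t : ZMod p,
      ((s • b + (u • w₁ b ω + t • w₂ b ω)) ⬝ᵥ (s • b + (u • w₁ b ω + t • w₂ b ω)) = 0) ↔
        u ^ 2 = -(B / Q₁) * s ^ 2 - B * t ^ 2 := by
    intro s u t
    have e : (s • b + (u • w₁ b ω + t • w₂ b ω)) ⬝ᵥ (s • b + (u • w₁ b ω + t • w₂ b ω)) =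
        s ^ 2 * B + Q₁ * (u ^ 2 + B * t ^ 2) := by
      simp only [add_dotProduct, dotProduct_add, smul_dotProduct, dotProduct_smul, smul_eq_mul,
        w₁_dot_x, w₂_dot_x, dotProduct_comm b (w₁ b ω), dotProduct_comm b (w₂ b ω),
        dotProduct_comm (w₂ b ω) (w₁ b ω), w₁_dot_w₂, w₂_dot_self, mul_zero, add_zero, zero_add]
      rw [← hB, ← hQ₁]
      ring
    rw [e]
    constructor
    · intro h
      have h' : Q₁ * (u ^ 2 + B / Q₁ * s ^ 2 + B * t ^ 2) = 0 := by
        have : Q₁ * (B / Q₁ * s ^ 2) = s ^ 2 * B := by field_simp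
        linear_combination h + this
      linear_combination (mul_eq_zero.mp h').resolve_left hQ
    · intro h
      have : Q₁ * (B / Q₁ * s ^ 2) = s ^ 2 * B := by field_simp
      linear_combination Q₁ * h - this
  simp_rw [key]
  rw [Finset.sum_congr rfl fun s _ => Finset.sum_comm]
  simp_rw [sum_sq_eq hp2]
  simp only [Finset.sum_add_distrib, Finset.sum_const, Finset.card_univ, ZMod.card, nsmul_eq_mul,
    mul_one]
  have hD : (0 : ZMod p) ^ 2 - 4 * (-(B / Q₁)) * (-B) ≠ 0 := by
    have h4 : (4 : ZMod p) ≠ 0 := by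
      rw [show (4 : ZMod p) = 2 * 2 by norm_num]
      exact mul_ne_zero (two_ne_zero_zmod hp2) (two_ne_zero_zmod hp2)
    rw [show (0 : ZMod p) ^ 2 - 4 * (-(B / Q₁)) * (-B) = -(4 * (B * B / Q₁)) by ring]
    exact neg_ne_zero.mpr (mul_ne_zero h4 (div_ne_zero (mul_ne_zero hb hb) hQ))
  have h0 := sum_bqf_eq_zero hp2 hD
  simp only [zero_mul, add_zero] at h0
  have h0' : ∑ s : ZMod p, ∑ t : ZMod p,
      quadraticChar (ZMod p) (-(B / Q₁) * s ^ 2 - B * t ^ 2) = 0 := by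
    rw [← h0]
    refine Finset.sum_congr rfl fun s _ => Finset.sum_congr rfl fun t _ => ?_
    congr 1; ring
  rw [h0']
  ring

end Counts

/-! ## From vectors to lines -/

section Lines

/-- **Fibre count.**  A homogeneous condition holds on exactly `(p − 1)·#{lines}` non-zero
vectors. -/
theorem card_lines (P : V p → Prop) [DecidablePred P]
    (hP : ∀ (a : (ZMod p)ˣ) (v : V p), P (a • v) ↔ P v) :
    ((Finset.univ.filter fun v : V p => v ≠ 0 ∧ P v).card : ℤ) =
      ((p : ℤ) - 1) * (Finset.univ.filter fun ℓ : ℙ (ZMod p) (V p) => P ℓ.rep).card := by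
  classical
  have he : (![1, 0, 0] : V p) ≠ 0 := fun h => by simpa using congrFun h 0
  set f : V p → ℙ (ZMod p) (V p) :=
    fun v => if h : v = 0 then Projectivization.mk (ZMod p) ![1, 0, 0] he
      else Projectivization.mk (ZMod p) v h with hf
  have hfv : ∀ {v : V p} (hv : v ≠ 0), f v = Projectivization.mk (ZMod p) v hv := by
    intro v hv; rw [hf]; exact dif_neg hv
  set S := Finset.univ.filter fun v : V p => v ≠ 0 ∧ P v with hS
  set T := Finset.univ.filter fun ℓ : ℙ (ZMod p) (V p) => P ℓ.rep with hT
  have hmaps : ∀ v ∈ S, f v ∈ T := by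
    intro v hv
    obtain ⟨hv0, hPv⟩ := (Finset.mem_filter.mp hv).2
    obtain ⟨a, ha⟩ := Projectivization.exists_smul_eq_mk_rep (ZMod p) v hv0
    refine Finset.mem_filter.mpr ⟨Finset.mem_univ _, ?_⟩
    rw [hfv hv0, ← ha]
    exact (hP a v).mpr hPv
  have hfib : ∀ ℓ ∈ T, (S.filter fun v => f v = ℓ).card = p - 1 := by
    intro ℓ hℓ
    have hPℓ : P ℓ.rep := (Finset.mem_filter.mp hℓ).2
    have himg : S.filter (fun v => f v = ℓ) =
        (Finset.univ : Finset (ZMod p)ˣ).image fun a => a • ℓ.rep := by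
      ext v
      simp only [Finset.mem_filter, Finset.mem_univ, true_and, Finset.mem_image, hS]
      constructor
      · rintro ⟨⟨hv0, -⟩, hvℓ⟩
        rw [hfv hv0, ← Projectivization.mk_rep ℓ, Projectivization.mk_eq_mk_iff] at hvℓ
        exact hvℓ
      · rintro ⟨a, rfl⟩
        have ha0 : a • ℓ.rep ≠ 0 := (smul_ne_zero_iff_ne a).mpr ℓ.rep_nonzero
        refine ⟨⟨ha0, (hP a _).mpr hPℓ⟩, ?_⟩
        rw [hfv ha0]
        conv_rhs => rw [← Projectivization.mk_rep ℓ]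
        rw [Projectivization.mk_eq_mk_iff]
        exact ⟨a, rfl⟩
    rw [himg, Finset.card_image_of_injective _ fun a a' h => ?_, Finset.card_univ, ZMod.card_units]
    have h' : ((a : ZMod p) - a') • ℓ.rep = 0 := by
      rw [sub_smul, sub_eq_zero]; exact h
    exact Units.ext (sub_eq_zero.mp ((smul_eq_zero.mp h').resolve_right ℓ.rep_nonzero))
  rw [Finset.card_eq_sum_card_fiberwise hmaps, Finset.sum_congr rfl hfib, Finset.sum_const,
    smul_eq_mul, Nat.cast_mul, Nat.cast_sub hp.out.one_lt.le, Nat.cast_one, mul_comm]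

/-- **There are `p + 1` isotropic lines in `𝔽_p³`** (`p` odd). -/
theorem card_isoLines (hp2 : p ≠ 2) :
    ((Finset.univ.filter fun ℓ : ℙ (ZMod p) (V p) => ℓ.rep ⬝ᵥ ℓ.rep = 0).card : ℤ) = p + 1 := by
  classical
  have hb : (![1, 0, 0] : V p) ⬝ᵥ ![1, 0, 0] ≠ 0 := by simp [dotProduct, Fin.sum_univ_three]
  obtain ⟨ω, hQ⟩ := exists_frame hp2 hb
  have hcount := count_space hp2 hb hQ
  have hlines := card_lines (P := fun v : V p => v ⬝ᵥ v = 0) fun a v => by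
    rw [Units.smul_def, smul_dotProduct, dotProduct_smul, smul_eq_mul, smul_eq_mul, ← mul_assoc]
    exact ⟨fun h => (mul_eq_zero.mp h).resolve_left (mul_ne_zero a.ne_zero a.ne_zero),
      fun h => by rw [h, mul_zero]⟩
  -- split off the zero vector from the affine count
  have hsplit : ∑ v : V p, (if v ⬝ᵥ v = 0 then (1 : ℤ) else 0) =
      1 + ((Finset.univ.filter fun v : V p => v ≠ 0 ∧ v ⬝ᵥ v = 0).card : ℤ) := by
    rw [Finset.sum_boole]
    have hset : (Finset.univ.filter fun v : V p => v ⬝ᵥ v = 0) =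
        insert 0 (Finset.univ.filter fun v : V p => v ≠ 0 ∧ v ⬝ᵥ v = 0) := by
      ext v
      simp only [Finset.mem_filter, Finset.mem_univ, true_and, Finset.mem_insert]
      constructor
      · intro h
        by_cases hv : v = 0
        · exact Or.inl hv
        · exact Or.inr ⟨hv, h⟩
      · rintro (rfl | ⟨-, h⟩)
        · simp
        · exact h
    rw [hset, Finset.card_insert_of_notMem (by simp), Nat.cast_add, Nat.cast_one, add_comm]
  rw [hsplit, hlines] at hcount
  have hp1 : ((p : ℤ) - 1) ≠ 0 := by
    have := hp.out.one_lt; omega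
  apply mul_left_cancel₀ hp1
  linear_combination hcount

/-- **An anisotropic `b` is orthogonal to `1 + χ(−Q b)` isotropic lines** (`p` odd). -/
theorem card_isoLines_perp (hp2 : p ≠ 2) {b : V p} (hb : b ⬝ᵥ b ≠ 0) :
    ((Finset.univ.filter fun ℓ : ℙ (ZMod p) (V p) =>
        ℓ.rep ⬝ᵥ ℓ.rep = 0 ∧ ℓ.rep ⬝ᵥ b = 0).card : ℤ) =
      1 + quadraticChar (ZMod p) (-(b ⬝ᵥ b)) := by
  classical
  obtain ⟨ω, hQ⟩ := exists_frame hp2 hb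
  have hcount := count_perp hp2 hb hQ
  have hlines := card_lines (P := fun v : V p => v ⬝ᵥ v = 0 ∧ v ⬝ᵥ b = 0) fun a v => by
    rw [Units.smul_def, smul_dotProduct, dotProduct_smul, smul_dotProduct, smul_eq_mul, smul_eq_mul,
      smul_eq_mul, ← mul_assoc]
    have ha := a.ne_zero
    refine ⟨fun ⟨h1, h2⟩ => ⟨(mul_eq_zero.mp h1).resolve_left (mul_ne_zero ha ha),
      (mul_eq_zero.mp h2).resolve_left ha⟩, fun ⟨h1, h2⟩ => ?_⟩
    rw [h1, h2, mul_zero, mul_zero]; exact ⟨rfl, rfl⟩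
  have hsplit : ∑ z ∈ Finset.univ.filter (fun z : V p => z ⬝ᵥ b = 0),
      (if z ⬝ᵥ z = 0 then (1 : ℤ) else 0) =
      1 + ((Finset.univ.filter fun v : V p => v ≠ 0 ∧ (v ⬝ᵥ v = 0 ∧ v ⬝ᵥ b = 0)).card : ℤ) := by
    rw [Finset.sum_boole, Finset.filter_filter]
    have hset : (Finset.univ.filter fun v : V p => v ⬝ᵥ b = 0 ∧ v ⬝ᵥ v = 0) =
        insert 0 (Finset.univ.filter fun v : V p => v ≠ 0 ∧ (v ⬝ᵥ v = 0 ∧ v ⬝ᵥ b = 0)) := by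
      ext v
      simp only [Finset.mem_filter, Finset.mem_univ, true_and, Finset.mem_insert]
      constructor
      · rintro ⟨h1, h2⟩
        by_cases hv : v = 0
        · exact Or.inl hv
        · exact Or.inr ⟨hv, h2, h1⟩
      · rintro (rfl | ⟨-, h2, h1⟩)
        · simp
        · exact ⟨h1, h2⟩
    rw [hset, Finset.card_insert_of_notMem (by simp), Nat.cast_add, Nat.cast_one, add_comm]
  rw [hsplit, hlines] at hcount
  have hp1 : ((p : ℤ) - 1) ≠ 0 := by
    have := hp.out.one_lt; omega
  apply mul_left_cancel₀ hp1
  linear_combination hcount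

end Lines

end ReflectionClassIsoLines
end Summit.MatrixMultiplication.MatrixMultiplication.Theorems.SubgroupIdentityDesigns.Negative
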